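import Summits.NavierStokesRegularity.FluidComputer.PalasekTowerLundgrenChildCeilingNumeric
import Literature.Analysis.FluidPDE.PlanarVorticityEntropy
import Mathlib.MeasureTheory.Measure.Haar.NormedSpace

/-!
# REGISTER v2.3″ (continued): THE ENTROPY CLOCK of a Lundgren-carried child core — ANY positive
# log-tame cross-section relaxes to the Burgers vortex in `L¹` at the rate `e^{−λA_k s/2}`

Cell `ns-blowup`, seat `ns-blowup-ecbridge-8` (g9); evidence toward crux 19250 `HeredityFromTwo`
(floors `stub_speed_floors` / `stub_core_floors` and the UPPER half `stub_window_ceiling`) of route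
`PalasekTowerBreakdown`, in the MODEL lane and with the MODEL IDENTIFICATION of
`PalasekTowerLundgrenChildLaws` («child core = cross-section of Lundgren's stretched flow in the host
strain `c = λA_k` at `ν = 1`», cross-section circulation `Γ`). The g3–g8 register table certifies the
speed / strain / core faces for the BURGERS child and, after g7's relaxation clock, for every RADIAL
child, while for the ANY-(co-signed)-profile class the floor and ceiling certificates are DISJOINT
(`palasekTowerBreakdown_anyProfile_thresholds_disjoint`: the extremal profiles of the two bounds differ).
This file supplies the missing dynamics for the any-profile class: Gallay–Wayne's entropy
dissipation method (Comm. Math. Phys. 255 (2005), Lemma 3.2 and §3.4; tree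
`Literature.Analysis.FluidPDE.PlanarVorticityEntropy`, with the Stam–Gross logarithmic Sobolev
inequality `EuclideanLogSobolevDecay` and the Csiszár–Kullback–Pinsker inequality
`CsiszarKullbackPinsker`) read through Lundgren's clock `τ(s) = (e^{cs} − 1)/c` (Saffman §13.3 (26)):
with the virtual origin `t⋆ = 1/c` the spreading Gaussian of the planar run IS, in Lundgren's
variables, the steady Burgers vorticity `Γc/(4π) e^{−c‖y‖²/4}` at every strain time, and
Gallay–Wayne's `e^{−τ}` is exactly `e^{−cs}`:

* `palasekTowerBreakdown_anyProfile_relEntropy_clock` — **the relative entropy of the cross-section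
  with respect to the Burgers profile decays by `e^{−1}` per strain time**:
  `H(τ(s)) ≤ H(0) · e^{−λA_k s}` for every `s ≥ 0` of the window;
* `palasekTowerBreakdown_anyProfile_L1_clock` — **`L¹` relaxation of the cross-section**:
  `∫ |ω̃(τ(s)) − g_{τ(s)}| ≤ (2ΓH(0))^{1/2} e^{−λA_k s/2}`;
* `burgersVorticity_eq_lundgren_gaussian` — the dictionary: `e^{cs} g_{τ(s)}(e^{cs/2} y)` is the
  Burgers vorticity `burgersVorticity c 1 Γ` at `(y, z)`, for all `s`;
* `palasekTowerBreakdown_anyProfile_childVorticity_L1_burgers_clock` — **the 3D reading**: on every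
  cross-section `{x₂ = z₀}` of the child, `∫ |ω_z(s, ·, z₀) − ω_Burgers| dy ≤ (2ΓH(0))^{1/2} e^{−λA_k s/2}`
  (Lundgren's axial vorticity `e^{cs} ω̃(τ(s), e^{cs/2}y)`, `Lundgren.curl_lundgren_apply_two`, and the
  scale invariance of the planar `L¹` norm);
* `palasekTowerBreakdown_anyProfile_L1_clock_threshold` — the clock as a NUMBER of strain times:
  after `s` strain-time units with `e^{λA_k s} ≥ 2ΓH(0)/ε²` the `L¹` defect to Burgers is `≤ ε`.

READING for 19250 (numbers, not adjectives): the any-profile class is no longer static — every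
positive log-tame child core converges in `L¹` (cross-section by cross-section, uniformly in `z`) to
the Burgers child of the same circulation, with an EXPLICIT clock `s_ε = λA_k⁻¹ log(2ΓH(0)/ε²)` set by
ONE number of the hand-over slice, its relative entropy `H(0)` with respect to the Burgers profile;
after the clock the core face (circulation in the disc of radius `1/N_{k+1}`) and every `L¹`-continuous
readout are those of the Burgers band up to `ε`. What the clock does NOT yet move: the sup-norm
readouts (max swirl speed, peak gradient) need an `L^∞`/Lipschitz modulus on top of `L¹` (the tree's
interpolation `BiotSavart2DSupInterpolation` turns `L¹` + the any-profile `L^∞` ceiling of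
`PalasekTowerLundgrenChildCeilingNumeric` into a swirl-speed modulus `∝ ε^{1/2}` — not typed here).

WHAT THIS IS NOT: not NS about any registered flow — exact INFINITE-ENERGY Lundgren flows, no
registered stage; nothing is asserted about `AprioriCeiling`, `WindowCeilingAt`, `ReadoutFloors` or
any crux; the identification «child core = Lundgren cross-section» is a MODEL step; positivity and
log-tameness of the cross-section (`0 < ω̃`, `|log ω̃| ≤ L(1+‖η‖)^m`, `‖∇ω̃‖ ≤ L(1+‖η‖)^m ω̃` on the
planar time set) are HYPOTHESES (Gallay–Wayne's Schwartz-class + Osada lower-bound step).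

References: Th. Gallay, C. E. Wayne, Comm. Math. Phys. 255 (2005), Lemma 3.2, §3.4
[cite: GallayWayne2005, Lemma 3.2 and §3.4]; P. G. Saffman, *Vortex Dynamics*, CUP 1992, §13.3
(26)–(31) [cite: Saffman1992, §13.3 eqs. (26)–(31)]; U. Frisch, *Turbulence*, CUP 1995, (8.140)
(Burgers vorticity) [cite: Frisch1995, §8.9.1 eq. (8.140)]; S. Palasek, arXiv:2605.13827, §3 (3.2)
[cite: Palasek2026ElementaryModel, §3 (3.2)].
-/

namespace Summit.NavierStokesRegularity.FluidComputer.PalasekTowerClayBridge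

open Real Set MeasureTheory
open Literature.Analysis.FluidPDE Literature.Analysis.FluidPDE.Lundgren

variable {S S' : Set ℝ}
  {v : ℝ → EuclideanSpace ℝ (Fin 2) → EuclideanSpace ℝ (Fin 2)}
  {q : ℝ → EuclideanSpace ℝ (Fin 2) → ℝ} {w : ℝ → EuclideanSpace ℝ (Fin 2) → ℝ}

/-! ### §0 Clock algebra -/

/-- The scalar vorticity of the zero planar field vanishes. [folklore] -/
private theorem planarVorticity_zero_force'' (σ : ℝ) (η : EuclideanSpace ℝ (Fin 2)) :
    PlanarEigenmode.vorticity ((0 : ℝ → EuclideanSpace ℝ (Fin 2) → EuclideanSpace ℝ (Fin 2)) σ) η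
      = 0 := by
  rw [Pi.zero_apply, PlanarEigenmode.vorticity_def,
    show (0 : EuclideanSpace ℝ (Fin 2) → EuclideanSpace ℝ (Fin 2)) = fun _ => 0 from rfl]
  simp

/-- Lundgren's clock with the virtual origin `1/c`: `(e^{cs} − 1)/c + c⁻¹ = e^{cs}/c`. [folklore] -/
private theorem clock_add_inv {c : ℝ} (hc : c ≠ 0) (s : ℝ) :
    (exp (c * s) - 1) / c + c⁻¹ = exp (c * s) / c := by
  field_simp
  ring

/-- `c⁻¹ / (e^{cs}/c) = e^{−cs}`. [folklore] -/
private theorem inv_div_clock {c : ℝ} (hc : c ≠ 0) (s : ℝ) :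
    c⁻¹ / (exp (c * s) / c) = exp (-(c * s)) := by
  rw [Real.exp_neg]
  field_simp

/-- `√(e^{−cs}) = e^{−cs/2}`. [folklore] -/
private theorem sqrt_exp_neg (c s : ℝ) : Real.sqrt (exp (-(c * s))) = exp (-(c * s / 2)) := by
  have h : exp (-(c * s)) = exp (-(c * s / 2)) ^ 2 := by
    rw [sq, ← Real.exp_add]; ring_nf
  rw [h, Real.sqrt_sq (exp_pos _).le]

/-! ### §1 The entropy clock in Lundgren's planar time -/

/-- **THE ENTROPY CLOCK** (`ν = 1`, host strain `c = λA_k`; MODEL lane). Let the child's cross-section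
be a classical unforced planar Navier–Stokes run `(ṽ, q̃)` on a convex planar-time set `S'`
(`ṽ = K₂ ∗ ω̃`, uniformly rapidly decaying vorticity) which is POSITIVE and LOG-TAME on `S'`, with
`0 ∈ S'` (the hand-over slice) and circulation `Γ = ∫ ω̃(0)`; let
`g_τ = Γ (4π(τ + c⁻¹))⁻¹ e^{−‖η‖²/(4(τ + c⁻¹))}` (the spreading Gaussian with virtual origin `c⁻¹` — in
Lundgren's variables the steady Burgers profile, `burgersVorticity_eq_lundgren_gaussian`) and
`H(τ) = ∫ ω̃(τ) log(ω̃(τ)/g_τ)`. Then for every strain time `s ≥ 0` whose Lundgren time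
`τ(s) = (e^{cs} − 1)/c` lies in `S'`: **`H(τ(s)) ≤ H(0) · e^{−cs}`** — Gallay–Wayne's
`H(w(τ)) − H(αG) ≤ (H(w₀) − H(αG)) e^{−τ}` with `e^{τ} = e^{cs}`
(`IsClassicalNSSolutionOn.relEntropy_mul_le` at `t₀ = 0`, `t⋆ = c⁻¹`). -/
theorem palasekTowerBreakdown_anyProfile_relEntropy_clock (R : TowerRates) (k : ℕ)
    {l : ℝ} (hl : 0 < l) (hS' : Convex ℝ S') (hv : IsClassicalNSSolutionOn S' 1 0 v q)
    (hω : HasUniformRapidDecayOn S' (fun σ η => PlanarEigenmode.vorticity (v σ) η))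
    (hBS : ∀ σ ∈ S', ∀ η, v σ η = biotSavart2D (PlanarEigenmode.vorticity (v σ)) η)
    (hpos : ∀ σ ∈ S', ∀ η, 0 < PlanarEigenmode.vorticity (v σ) η) {L : ℝ} {m : ℕ}
    (hlog : ∀ σ ∈ S', ∀ η, |Real.log (PlanarEigenmode.vorticity (v σ) η)| ≤ L * (1 + ‖η‖) ^ m)
    (hsc : ∀ σ ∈ S', ∀ η, ‖fderiv ℝ (PlanarEigenmode.vorticity (v σ)) η‖ ≤
      L * (1 + ‖η‖) ^ m * PlanarEigenmode.vorticity (v σ) η)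
    (h0 : (0 : ℝ) ∈ S') {s : ℝ} (hs : 0 ≤ s)
    (hτs : (exp (l * R.A k * s) - 1) / (l * R.A k) ∈ S') :
    (∫ η, PlanarEigenmode.vorticity (v ((exp (l * R.A k * s) - 1) / (l * R.A k))) η *
        Real.log (PlanarEigenmode.vorticity (v ((exp (l * R.A k * s) - 1) / (l * R.A k))) η /
          ((∫ y, PlanarEigenmode.vorticity (v 0) y) /
              (4 * π * ((exp (l * R.A k * s) - 1) / (l * R.A k) + (l * R.A k)⁻¹)) *
            exp (-(‖η‖ ^ 2 / (4 * ((exp (l * R.A k * s) - 1) / (l * R.A k) + (l * R.A k)⁻¹))))))) ≤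
      (∫ η, PlanarEigenmode.vorticity (v 0) η *
        Real.log (PlanarEigenmode.vorticity (v 0) η /
          ((∫ y, PlanarEigenmode.vorticity (v 0) y) / (4 * π * (l * R.A k)⁻¹) *
            exp (-(‖η‖ ^ 2 / (4 * (l * R.A k)⁻¹)))))) * exp (-(l * R.A k * s)) := by
  set c : ℝ := l * R.A k with hc
  have hcpos : 0 < c := mul_pos hl (R.A_pos k)
  have hcurl : ∀ σ ∈ S', ∀ η, PlanarEigenmode.vorticity
      ((0 : ℝ → EuclideanSpace ℝ (Fin 2) → EuclideanSpace ℝ (Fin 2)) σ) η = 0 :=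
    fun σ _ η => planarVorticity_zero_force'' σ η
  have hτ0 : (0 : ℝ) ≤ (exp (c * s) - 1) / c :=
    div_nonneg (by linarith [one_le_exp (mul_nonneg hcpos.le hs)]) hcpos.le
  have h := hv.relEntropy_mul_le hS' one_pos hω hBS hcurl hpos hlog hsc h0 hτs hτ0
    (tstar := c⁻¹) (inv_pos.2 hcpos)
  simp only [mul_one, sub_zero] at h
  -- `H(τ(s)) · e^{cs}/c ≤ H(0) · c⁻¹`
  rw [clock_add_inv hcpos.ne'] at h ⊢
  have h2 := (le_div_iff₀ (div_pos (exp_pos (c * s)) hcpos)).2 h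
  rwa [mul_div_assoc, inv_div_clock hcpos.ne'] at h2

/-! ### §2 The `L¹` clock -/

/-- **THE `L¹` CLOCK** (same setting): **`∫ |ω̃(τ(s)) − g_{τ(s)}| ≤ (2 Γ H(0))^{1/2} · e^{−cs/2}`** —
Gallay–Wayne's `‖w(τ) − αG‖_{L¹} ≤ √(2α)(H(w₀) − H(αG))^{1/2} e^{−τ/2}` with `e^{τ} = e^{cs}`
(`IsClassicalNSSolutionOn.integral_abs_planarVorticity_sub_gaussian_le` at `t₀ = 0`, `t⋆ = c⁻¹`). -/
theorem palasekTowerBreakdown_anyProfile_L1_clock (R : TowerRates) (k : ℕ)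
    {l : ℝ} (hl : 0 < l) (hS' : Convex ℝ S') (hv : IsClassicalNSSolutionOn S' 1 0 v q)
    (hω : HasUniformRapidDecayOn S' (fun σ η => PlanarEigenmode.vorticity (v σ) η))
    (hBS : ∀ σ ∈ S', ∀ η, v σ η = biotSavart2D (PlanarEigenmode.vorticity (v σ)) η)
    (hpos : ∀ σ ∈ S', ∀ η, 0 < PlanarEigenmode.vorticity (v σ) η) {L : ℝ} {m : ℕ}
    (hlog : ∀ σ ∈ S', ∀ η, |Real.log (PlanarEigenmode.vorticity (v σ) η)| ≤ L * (1 + ‖η‖) ^ m)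
    (hsc : ∀ σ ∈ S', ∀ η, ‖fderiv ℝ (PlanarEigenmode.vorticity (v σ)) η‖ ≤
      L * (1 + ‖η‖) ^ m * PlanarEigenmode.vorticity (v σ) η)
    (h0 : (0 : ℝ) ∈ S') {s : ℝ} (hs : 0 ≤ s)
    (hτs : (exp (l * R.A k * s) - 1) / (l * R.A k) ∈ S') :
    ∫ η, |PlanarEigenmode.vorticity (v ((exp (l * R.A k * s) - 1) / (l * R.A k))) η -
        (∫ y, PlanarEigenmode.vorticity (v 0) y) /
            (4 * π * ((exp (l * R.A k * s) - 1) / (l * R.A k) + (l * R.A k)⁻¹)) *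
          exp (-(‖η‖ ^ 2 / (4 * ((exp (l * R.A k * s) - 1) / (l * R.A k) + (l * R.A k)⁻¹))))| ≤
      Real.sqrt (2 * (∫ y, PlanarEigenmode.vorticity (v 0) y) *
        ∫ η, PlanarEigenmode.vorticity (v 0) η *
          Real.log (PlanarEigenmode.vorticity (v 0) η /
            ((∫ y, PlanarEigenmode.vorticity (v 0) y) / (4 * π * (l * R.A k)⁻¹) *
              exp (-(‖η‖ ^ 2 / (4 * (l * R.A k)⁻¹)))))) * exp (-(l * R.A k * s / 2)) := by
  set c : ℝ := l * R.A k with hc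
  have hcpos : 0 < c := mul_pos hl (R.A_pos k)
  have hcurl : ∀ σ ∈ S', ∀ η, PlanarEigenmode.vorticity
      ((0 : ℝ → EuclideanSpace ℝ (Fin 2) → EuclideanSpace ℝ (Fin 2)) σ) η = 0 :=
    fun σ _ η => planarVorticity_zero_force'' σ η
  have hτ0 : (0 : ℝ) ≤ (exp (c * s) - 1) / c :=
    div_nonneg (by linarith [one_le_exp (mul_nonneg hcpos.le hs)]) hcpos.le
  have h := hv.integral_abs_planarVorticity_sub_gaussian_le hS' one_pos hω hBS hcurl hpos hlog hsc h0
    hτs hτ0 (tstar := c⁻¹) (inv_pos.2 hcpos)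
  simp only [mul_one, sub_zero] at h
  refine h.trans (le_of_eq ?_)
  rw [clock_add_inv hcpos.ne', mul_div_assoc, inv_div_clock hcpos.ne', Real.sqrt_mul' _ (exp_pos _).le,
    sqrt_exp_neg]

/-- **THE CLOCK AS A NUMBER OF STRAIN TIMES**: in the same setting, for `ε > 0`, once
`e^{cs} ≥ 2ΓH(0)/ε²` (i.e. after `s ≥ λA_k⁻¹ log(2ΓH(0)/ε²)` strain-time units) the `L¹` defect of the
cross-section to the Burgers-normalised Gaussian is `≤ ε`. [cite: GallayWayne2005, §3.4 ("an explicit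
upper bound of the time needed for the solution to enter a given neighborhood of the vortex")] -/
theorem palasekTowerBreakdown_anyProfile_L1_clock_threshold (R : TowerRates) (k : ℕ)
    {l : ℝ} (hl : 0 < l) (hS' : Convex ℝ S') (hv : IsClassicalNSSolutionOn S' 1 0 v q)
    (hω : HasUniformRapidDecayOn S' (fun σ η => PlanarEigenmode.vorticity (v σ) η))
    (hBS : ∀ σ ∈ S', ∀ η, v σ η = biotSavart2D (PlanarEigenmode.vorticity (v σ)) η)
    (hpos : ∀ σ ∈ S', ∀ η, 0 < PlanarEigenmode.vorticity (v σ) η) {L : ℝ} {m : ℕ}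
    (hlog : ∀ σ ∈ S', ∀ η, |Real.log (PlanarEigenmode.vorticity (v σ) η)| ≤ L * (1 + ‖η‖) ^ m)
    (hsc : ∀ σ ∈ S', ∀ η, ‖fderiv ℝ (PlanarEigenmode.vorticity (v σ)) η‖ ≤
      L * (1 + ‖η‖) ^ m * PlanarEigenmode.vorticity (v σ) η)
    (h0 : (0 : ℝ) ∈ S') {s : ℝ} (hs : 0 ≤ s)
    (hτs : (exp (l * R.A k * s) - 1) / (l * R.A k) ∈ S') {ε : ℝ} (hε : 0 < ε)
    (hclock : 2 * (∫ y, PlanarEigenmode.vorticity (v 0) y) *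
        (∫ η, PlanarEigenmode.vorticity (v 0) η *
          Real.log (PlanarEigenmode.vorticity (v 0) η /
            ((∫ y, PlanarEigenmode.vorticity (v 0) y) / (4 * π * (l * R.A k)⁻¹) *
              exp (-(‖η‖ ^ 2 / (4 * (l * R.A k)⁻¹)))))) / ε ^ 2 ≤ exp (l * R.A k * s)) :
    ∫ η, |PlanarEigenmode.vorticity (v ((exp (l * R.A k * s) - 1) / (l * R.A k))) η -
        (∫ y, PlanarEigenmode.vorticity (v 0) y) /
            (4 * π * ((exp (l * R.A k * s) - 1) / (l * R.A k) + (l * R.A k)⁻¹)) *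
          exp (-(‖η‖ ^ 2 / (4 * ((exp (l * R.A k * s) - 1) / (l * R.A k) + (l * R.A k)⁻¹))))| ≤ ε := by
  have h := palasekTowerBreakdown_anyProfile_L1_clock R k hl hS' hv hω hBS hpos hlog hsc h0 hs hτs
  refine h.trans ?_
  set A : ℝ := 2 * (∫ y, PlanarEigenmode.vorticity (v 0) y) *
    ∫ η, PlanarEigenmode.vorticity (v 0) η *
      Real.log (PlanarEigenmode.vorticity (v 0) η /
        ((∫ y, PlanarEigenmode.vorticity (v 0) y) / (4 * π * (l * R.A k)⁻¹) *
          exp (-(‖η‖ ^ 2 / (4 * (l * R.A k)⁻¹))))) with hA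
  -- `√A · e^{−cs/2} ≤ ε ⇔ A e^{−cs} ≤ ε²`
  have hA' : A ≤ ε ^ 2 * exp (l * R.A k * s) := by
    rw [div_le_iff₀ (by positivity)] at hclock; linarith
  have hprod : Real.sqrt A * exp (-(l * R.A k * s / 2)) =
      Real.sqrt (A * exp (-(l * R.A k * s))) := by
    rw [Real.sqrt_mul' _ (exp_pos _).le, sqrt_exp_neg]
  rw [hprod]
  calc Real.sqrt (A * exp (-(l * R.A k * s))) ≤ Real.sqrt (ε ^ 2) := by
        refine Real.sqrt_le_sqrt ?_
        rw [Real.exp_neg, ← div_eq_mul_inv, div_le_iff₀ (exp_pos _)]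
        exact hA'
    _ = ε := Real.sqrt_sq hε.le

/-! ### §3 The three-dimensional reading: Lundgren's image of the Gaussian is the Burgers profile -/

/-- **THE DICTIONARY**: in Lundgren's variables at constant rate `c ≠ 0` (`a = e^{cs/2}`,
`τ = (e^{cs} − 1)/c`) the axial vorticity `a² g_τ(a y)` carried by the spreading Gaussian with virtual
origin `c⁻¹` is, for EVERY `s`, the steady Burgers vorticity `Γc/(4π) e^{−c‖y‖²/4} = burgersVorticity c 1 Γ`
at the point `(y, z)`. [cite: Saffman1992, §13.3 eqs. (26), (29); Frisch1995, §8.9.1 eq. (8.140)] -/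
theorem burgersVorticity_eq_lundgren_gaussian {c : ℝ} (hc : c ≠ 0) (Γ s z : ℝ)
    (y : EuclideanSpace ℝ (Fin 2)) :
    burgersVorticity c 1 Γ (embedXY y + z • eZ) =
      exp (c * s / 2) ^ 2 * (Γ / (4 * π * ((exp (c * s) - 1) / c + c⁻¹)) *
        exp (-(‖exp (c * s / 2) • y‖ ^ 2 / (4 * ((exp (c * s) - 1) / c + c⁻¹))))) := by
  rw [clock_add_inv hc]
  have hn : ‖y‖ ^ 2 = y 0 ^ 2 + y 1 ^ 2 := by
    rw [EuclideanSpace.norm_sq_eq, Fin.sum_univ_two, Real.norm_eq_abs, Real.norm_eq_abs, sq_abs, sq_abs]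
  have ha2 : exp (c * s / 2) ^ 2 = exp (c * s) := by rw [sq, ← Real.exp_add]; ring_nf
  have hx0 : (embedXY y + z • eZ) 0 = y 0 := by simp [eZ]
  have hx1 : (embedXY y + z • eZ) 1 = y 1 := by simp [eZ]
  rw [burgersVorticity, hx0, hx1, norm_smul, mul_pow, Real.norm_eq_abs, sq_abs, ha2, hn]
  have e1 : Γ / (4 * π * (exp (c * s) / c)) = c * Γ / (4 * π * 1) * exp (-(c * s)) := by
    rw [Real.exp_neg]; field_simp
  have e2 : -(exp (c * s) * (y 0 ^ 2 + y 1 ^ 2) / (4 * (exp (c * s) / c))) =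
      -(c * (y 0 ^ 2 + y 1 ^ 2) / (4 * 1)) := by
    field_simp
  rw [e1, e2]
  have hee : exp (c * s) * exp (-(c * s)) = 1 := by rw [← Real.exp_add, add_neg_cancel, Real.exp_zero]
  linear_combination (-(c * Γ / (4 * π * 1) * exp (-(c * (y 0 ^ 2 + y 1 ^ 2) / (4 * 1))))) * hee

/-- **THE 3D `L¹` CLOCK**: for the Lundgren child at constant rate `c = λA_k` carrying the planar run
`(ṽ, q̃)` of §1 (and any jointly smooth passive axial scalar `W̃`), on EVERY cross-section `{x₂ = z₀}`
and at every strain time `s ≥ 0` of the window `S` (mapped into `S'` by Lundgren's clock),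
**`∫ |ω_z(s, y, z₀) − ω_Burgers(y, z₀)| dy ≤ (2 Γ H(0))^{1/2} e^{−cs/2}`**, where
`ω_z = (curl u)₂ = e^{cs} ω̃(τ(s), e^{cs/2} y)` (`Lundgren.curl_lundgren_apply_two`) and `ω_Burgers =
burgersVorticity c 1 Γ`: the planar `L¹` clock is scale invariant under `y ↦ e^{cs/2} y`.
[cite: GallayWayne2005, §3.4; Saffman1992, §13.3 eq. (29)] -/
theorem palasekTowerBreakdown_anyProfile_childVorticity_L1_burgers_clock (R : TowerRates) (k : ℕ)
    {l : ℝ} (hl : 0 < l) (hS' : Convex ℝ S') (hv : IsClassicalNSSolutionOn S' 1 0 v q)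
    (hω : HasUniformRapidDecayOn S' (fun σ η => PlanarEigenmode.vorticity (v σ) η))
    (hBS : ∀ σ ∈ S', ∀ η, v σ η = biotSavart2D (PlanarEigenmode.vorticity (v σ)) η)
    (hpos : ∀ σ ∈ S', ∀ η, 0 < PlanarEigenmode.vorticity (v σ) η) {L : ℝ} {m : ℕ}
    (hlog : ∀ σ ∈ S', ∀ η, |Real.log (PlanarEigenmode.vorticity (v σ) η)| ≤ L * (1 + ‖η‖) ^ m)
    (hsc : ∀ σ ∈ S', ∀ η, ‖fderiv ℝ (PlanarEigenmode.vorticity (v σ)) η‖ ≤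
      L * (1 + ‖η‖) ^ m * PlanarEigenmode.vorticity (v σ) η)
    (hw : IsSmoothSpaceTimeOn S' w)
    (hmaps : MapsTo (fun t => (exp (l * R.A k * t) - 1) / (l * R.A k)) S S')
    (h0 : (0 : ℝ) ∈ S') {s : ℝ} (hsS : s ∈ S) (hs : 0 ≤ s) (z₀ : ℝ) :
    ∫ y : EuclideanSpace ℝ (Fin 2),
        |curl (velocity (fun _ => l * R.A k)
            (fun t y => exp (l * R.A k * t / 2) •
              v ((exp (l * R.A k * t) - 1) / (l * R.A k)) (exp (l * R.A k * t / 2) • y))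
            (fun t y => exp (-(l * R.A k * t)) •
              w ((exp (l * R.A k * t) - 1) / (l * R.A k)) (exp (l * R.A k * t / 2) • y)) s)
            (embedXY y + z₀ • eZ) 2 -
          burgersVorticity (l * R.A k) 1 (∫ y, PlanarEigenmode.vorticity (v 0) y) (embedXY y + z₀ • eZ)| ≤
      Real.sqrt (2 * (∫ y, PlanarEigenmode.vorticity (v 0) y) *
        ∫ η, PlanarEigenmode.vorticity (v 0) η *
          Real.log (PlanarEigenmode.vorticity (v 0) η /
            ((∫ y, PlanarEigenmode.vorticity (v 0) y) / (4 * π * (l * R.A k)⁻¹) *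
              exp (-(‖η‖ ^ 2 / (4 * (l * R.A k)⁻¹)))))) * exp (-(l * R.A k * s / 2)) := by
  set c : ℝ := l * R.A k with hc
  have hcpos : 0 < c := mul_pos hl (R.A_pos k)
  set a : ℝ := exp (c * s / 2) with ha
  have hapos : 0 < a := exp_pos _
  set τ : ℝ := (exp (c * s) - 1) / c with hτ
  set Γ : ℝ := ∫ y, PlanarEigenmode.vorticity (v 0) y with hΓ
  -- the planar `L¹` clock at Lundgren time `τ(s)`
  have hplanar := palasekTowerBreakdown_anyProfile_L1_clock R k hl hS' hv hω hBS hpos hlog hsc h0 hs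
    (hmaps hsS)
  -- the integrand is `a² · |ω̃(τ) − g_τ|(a y)`
  set F : EuclideanSpace ℝ (Fin 2) → ℝ := fun η => |PlanarEigenmode.vorticity (v τ) η -
    Γ / (4 * π * (τ + c⁻¹)) * exp (-(‖η‖ ^ 2 / (4 * (τ + c⁻¹))))| with hF
  have hpt : ∀ y : EuclideanSpace ℝ (Fin 2),
      |curl (velocity (fun _ => c)
          (fun t y => exp (c * t / 2) • v ((exp (c * t) - 1) / c) (exp (c * t / 2) • y))
          (fun t y => exp (-(c * t)) • w ((exp (c * t) - 1) / c) (exp (c * t / 2) • y)) s)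
          (embedXY y + z₀ • eZ) 2 -
        burgersVorticity c 1 Γ (embedXY y + z₀ • eZ)| = a ^ 2 * F (a • y) := by
    intro y
    rw [curl_lundgren_apply_two (γ := fun _ => c) (a := fun t => exp (c * t / 2))
      (τ := fun t => (exp (c * t) - 1) / c) (d := fun t => exp (-(c * t))) hv.smooth_velocity hw hmaps
      hsS, projXY_add_smul_eZ, projXY_embedXY, burgersVorticity_eq_lundgren_gaussian hcpos.ne' Γ s z₀ y,
      hF]
    dsimp only
    rw [← mul_sub, abs_mul, abs_of_pos (pow_pos hapos 2)]
  simp_rw [hpt]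
  -- scale invariance of the planar `L¹` norm
  rw [integral_const_mul, Measure.integral_comp_smul volume F a, finrank_euclideanSpace_fin, smul_eq_mul,
    abs_of_pos (inv_pos.2 (pow_pos hapos 2)), ← mul_assoc, mul_inv_cancel₀ (pow_pos hapos 2).ne', one_mul]
  exact hplanar

end Summit.NavierStokesRegularity.FluidComputer.PalasekTowerClayBridge
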